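import Literature.Barriers.ValiantsHypothesis.GCTMatrixPoweringProp19
import Literature.NumberTheory.DiophantineGeometry.KroneckerPointSets
import Literature.NumberTheory.DiophantineGeometry.SchurWeylPlethysmHwMultiplicityProofs
import HarnessLib

/-!
# Gesmundo–Ikenmeyer–Panova 2017, Prop. 19 as PRINTED is false: `¬ GIP2017_prop19`

Sibling file (D-0014) of `GCTMatrixPoweringColumns.lean` (the named fact `GIP2017_prop19`, vendored
verbatim from GIP Prop. 19, arXiv:1611.00827 p. 11 = Diff. Geom. Appl. 55 (2017): "at least one of
the two quantities is positive: `sm((2,2,1^a), ℓ) > 0` or `am((2,2,1^a), ℓ) > 0`, where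
`ℓ = max{7, ⌈√(a+2)⌉}`") and of `GCTMatrixPoweringProp19.lean` (the CORRECTED Prop. 19 with
`ℓ = max{7, ⌈√(a+2)⌉ + 1}`, `GIP2017_prop19_corrected_holds`, through which the tree's proof of
GIP Thm. 10 = `GCTMatrixPowering` is threaded, `gctMatrixPowering_of_prop18`). That file's
docstring records why the printed bound fails at `a = s² - 2`, `s ≥ 7` (two-row rule for
`g((n-2,2), μ, ν)`); this file PROVES it, so that the named fact is formally refuted
(`GIP2017_prop19_false`) rather than left as an undischargeable hypothesis.

**Theorem** (`kroneckerCoeff_twoTwoCol_eq_zero`). Let `a + 2 = s²` and `μ ⊢ a + 4 = s² + 2` with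
`ℓ(μ) ≤ s`. Then `g((2,2,1^a), μ, μ) = 0` (over any field of characteristic zero). Hence
`sm((2,2,1^a), s) = am((2,2,1^a), s) = 0` (`not_smPos_twoTwoCol`, `not_amPos_twoTwoCol`, by GIP
(3.1) `g = sk + ak`, tree: `kroneckerCoeff_pos_of_skPos`/`_of_akPos`), and since
`max{7, ⌈√(a+2)⌉} = s` for `s ≥ 7`, Prop. 19 fails at every `a = s² - 2`, `s ≥ 7`
(`GIP2017_prop19_fails`); `a = 47` refutes `GIP2017_prop19` (`GIP2017_prop19_false`). The bound
`ℓ + 1` of the corrected statement is thus sharp along this sequence.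

**Proof** (a weight argument in the word model of the tree; GIP's own remark is via the two-row
rule, which the tree does not have). `g(λ, μ, μ) = g(μ, λ, μ) = g(μ, λᵀ, μᵀ)` (`S₃`-symmetry and the
transposition property), `λᵀ = (s², 2)`. If it were positive, IMW Lemma 2.1 in the tree's form
(`exists_antiInvariant_of_kroneckerCoeff_pos`, `KroneckerPointSets.lean`) gives a nonzero triple
tensor `M ∈ HW_μ ⊗ HW_{(s²,2)} ⊗ HW_μ` on triples of words `(u, v, w)`, ANTI-invariant under the
diagonal position action of `𝔖_{s²+2}`. Take `M(u, v, w) ≠ 0`: the contents are `(μ, (s², 2), μ)`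
and `p ↦ (u p, v p, w p)` is injective (IMW Lemma 2.2 and the sign trick,
`wordContent_eq_of_mem_tripleHw_of_ne_zero`, `zip3_injective_of_antiInvariant_of_ne_zero`). As
`ℓ(μ) ≤ s`, the letters of `u` and `w` are `< s`; `v` has `s²` letters `0` (positions `Z`) and two
letters `1` (positions `p ≠ q`). On `Z` the pairs `(u o, w o) ∈ [s]²` are distinct, so they
EXHAUST `[s]²`; in particular every letter occurs exactly `s` times in `u|_Z` and in `w|_Z`, and
`content(u) = content(w) = μ` leaves `{u p, u q} = {w p, w q}` as multisets, with `u p ≠ u q` by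
injectivity. Now the raising operator `E_{ij}`, `i = min < j = max` of these two letters, kills the
highest-weight partial functions (`wordRaise_eq_zero_of_mem_highestWeightSpace`, Fulton §8.2):
applied to `u[q ↦ i]` (say `u p = i`, `u q = j`) it reads `Σ_{o : u o = i or o = q} M(u[q↦i][o↦j], v, w) = 0`,
whose terms are `o = q` (giving `M(u,v,w)`), `o = p` (giving `M(u ∘ (p q), v, w)`) and `o ∈ Z` —
dead, because the new pair `(j, w o)` already sits at another position of `Z` and anti-invariance
under that transposition forces `0`. So `M(u,v,w) = -M(u∘(p q), v, w)` (`apply_add_apply_comp_swap_eq_zero`),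
and likewise in the third word. Chaining the `w`-exchange, the `u`-exchange and anti-invariance
under `(p q)` itself (`v ∘ (p q) = v`) gives `M(u,v,w) = -M(u,v,w)`, i.e. `M(u,v,w) = 0`
(`apply_eq_zero_of_exchange`) — a contradiction. (The point-set criterion of IMW alone does not
suffice: for `μ = (s+1, s+1, s^{s-2})` point sets with these marginals exist.)

## References

* [GesmundoIkenmeyerPanova2017] F. Gesmundo, C. Ikenmeyer, G. Panova, *Geometric complexity theory
  and matrix powering*, Diff. Geom. Appl. 55 (2017) 106–127 = arXiv:1611.00827, §3: (3.1),
  Prop. 19 and its printed proof (held text p. 11), Prop. 20.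
* [IkenmeyerMulmuleyWalter2017] C. Ikenmeyer, K. D. Mulmuley, M. Walter, *On vanishing of Kronecker
  coefficients*, Comput. Complexity 26 (2017), Lemmas 2.1–2.2 (anti-invariants and point sets).
* [FultonYoungTableaux1997] W. Fulton, *Young Tableaux* (1997), §8.2 (raising operators kill
  highest-weight vectors).
-/

noncomputable section

open scoped BigOperators

namespace Literature.Barriers.ValiantsHypothesis

open Literature.NumberTheory.DiophantineGeometry Literature.Computability.Complexity Finset

/-! ### 1. Two counting lemmas: an injection of an `s²`-set into `[s] × [s]` -/

section Counting

variable {α : Type*}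

/-- An injection of a set with `s²` elements into `[s] × [s]` is onto. [folklore] -/
theorem image_eq_range_product (Z : Finset α) (f g : α → ℕ) (s : ℕ)
    (hinj : Set.InjOn (fun o => (f o, g o)) Z) (hf : ∀ o ∈ Z, f o < s) (hg : ∀ o ∈ Z, g o < s)
    (hcard : Z.card = s * s) : Z.image (fun o => (f o, g o)) = range s ×ˢ range s := by
  apply eq_of_subset_of_card_le
  · intro xy hxy
    obtain ⟨o, ho, rfl⟩ := mem_image.mp hxy
    exact mem_product.mpr ⟨mem_range.mpr (hf o ho), mem_range.mpr (hg o ho)⟩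
  · rw [card_image_of_injOn hinj, hcard, card_product, card_range]

/-- If `o ↦ (f o, g o)` is a bijection of `Z` onto the square `[s] × [s]`, then each value is
taken equally often by `f` and by `g` on `Z` (rows and columns of a square have the same size).
[folklore] -/
theorem card_filter_fst_eq_card_filter_snd (Z : Finset α) (f g : α → ℕ) (s : ℕ)
    (hinj : Set.InjOn (fun o => (f o, g o)) Z)
    (himg : Z.image (fun o => (f o, g o)) = range s ×ˢ range s) (l : ℕ) :
    (Z.filter fun o => f o = l).card = (Z.filter fun o => g o = l).card := by
  have e1 : ((range s ×ˢ range s).filter fun xy : ℕ × ℕ => xy.1 = l).card =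
      (Z.filter fun o => f o = l).card := by
    rw [← himg, filter_image,
      card_image_of_injOn (hinj.mono (coe_subset.mpr (filter_subset _ _)))]
  have e2 : ((range s ×ˢ range s).filter fun xy : ℕ × ℕ => xy.2 = l).card =
      (Z.filter fun o => g o = l).card := by
    rw [← himg, filter_image,
      card_image_of_injOn (hinj.mono (coe_subset.mpr (filter_subset _ _)))]
  rw [← e1, ← e2, filter_product_left (fun x => x = l), filter_product_right (fun y => y = l),
    card_product, card_product, mul_comm]

end Counting

/-! ### 2. The exchange relation for anti-invariant triple tensors -/

section Exchange

variable {k : Type*} [Field k] [CharZero k] {N n : ℕ}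

/-- Exchanging the letters of `u` at `p` and `q`, written with two updates. [folklore] -/
theorem update_update_eq_comp_swap (u : Word N n) {p q : Fin n} (hpq : p ≠ q) :
    Function.update (Function.update u q (u p)) p (u q) = u ∘ ⇑(Equiv.swap p q) := by
  funext o
  simp only [Function.comp_apply]
  by_cases hop : o = p
  · subst hop
    rw [Function.update_self, Equiv.swap_apply_left]
  · rw [Function.update_of_ne hop]
    by_cases hoq : o = q
    · subst hoq
      rw [Function.update_self, Equiv.swap_apply_right]
    · rw [Function.update_of_ne hoq, Equiv.swap_apply_of_ne_of_ne hop hoq]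

/-- **The exchange relation.** Let `M` be a triple tensor on words, anti-invariant under the
diagonal position action and with first partial functions highest-weight vectors. Let
`t = (u, v, w)` and `p ≠ q` positions with `u p < u q` such that for every other
position `o` carrying the letter `u p` in `u` some fourth position `r` carries `(u q, v o, w o)`.
Then `M(u, v, w) + M(u ∘ (p q), v, w) = 0`: the raising operator `E_{u p, u q}` kills
`u' ↦ M(u', v, w)` (`wordRaise_eq_zero_of_mem_highestWeightSpace`); evaluated at `u[q ↦ u p]` its
terms are `M(u,v,w)` (position `q`), `M(u ∘ (p q), v, w)` (position `p`) and, for the other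
positions `o`, values of `M` at triples with two equal letter-triples (at `o` and `r`), which vanish
by anti-invariance (`zip3_injective_of_antiInvariant_of_ne_zero`).
[cite: FultonYoungTableaux1997, §8.2 (proof of Lemma 4)] -/
theorem apply_add_apply_comp_swap_eq_zero {χ : Weight (Fin N)} {M : Word3 N n → k}
    (hM : ∀ v w : Word N n, (fun u => M ((u, v), w)) ∈ highestWeightSpace (wordRep k N n) χ)
    (hanti : ∀ τ t, M (permute3 τ t) = ((Equiv.Perm.sign τ : ℤ) : k) * M t)
    (u v w : Word N n) {p q : Fin n} (hpq : p ≠ q) (hlt : u p < u q)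
    (hZ : ∀ o, o ≠ p → o ≠ q → u o = u p →
      ∃ r, r ≠ o ∧ r ≠ p ∧ r ≠ q ∧ u r = u q ∧ v r = v o ∧ w r = w o) :
    M ((u, v), w) + M ((u ∘ ⇑(Equiv.swap p q), v), w) = 0 := by
  classical
  set u₀ : Word N n := Function.update u q (u p) with hu₀
  have hraise := congrFun (wordRaise_eq_zero_of_mem_highestWeightSpace hlt (hM v w)) u₀
  simp only [wordRaise_apply, Pi.zero_apply] at hraise
  have hu₀p : u₀ p = u p := by rw [hu₀, Function.update_of_ne hpq]
  have hu₀q : u₀ q = u p := by rw [hu₀, Function.update_self]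
  have hu₀o : ∀ o, o ≠ q → u₀ o = u o := fun o ho => by rw [hu₀, Function.update_of_ne ho]
  have hqS : q ∈ univ.filter (fun o => u₀ o = u p) := by simp [hu₀q]
  have hpS : p ∈ (univ.filter (fun o => u₀ o = u p)).erase q :=
    mem_erase.mpr ⟨hpq, by simp [hu₀p]⟩
  rw [← add_sum_erase _ _ hqS, ← add_sum_erase _ _ hpS] at hraise
  have h1 : Function.update u₀ q (u q) = u := by
    rw [hu₀, Function.update_idem, Function.update_eq_self]
  have h2 : Function.update u₀ p (u q) = u ∘ ⇑(Equiv.swap p q) := by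
    rw [hu₀]
    exact update_update_eq_comp_swap u hpq
  have h3 : ∑ o ∈ ((univ.filter fun o => u₀ o = u p).erase q).erase p,
      M ((Function.update u₀ o (u q), v), w) = 0 := by
    refine sum_eq_zero fun o ho => ?_
    simp only [mem_erase, mem_filter, mem_univ, true_and] at ho
    obtain ⟨hop, hoq, ho⟩ := ho
    rw [hu₀o o hoq] at ho
    obtain ⟨r, hro, -, hrq, hur, hvr, hwr⟩ := hZ o hop hoq ho
    by_contra hne
    have hinj := zip3_injective_of_antiInvariant_of_ne_zero k hanti hne
    refine hro (hinj ?_)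
    have hu'r : Function.update u₀ o (u q) r = u q := by
      rw [Function.update_of_ne hro, hu₀o r hrq, hur]
    have hu'o : Function.update u₀ o (u q) o = u q := Function.update_self _ _ _
    show ((Function.update u₀ o (u q) r, v r), w r) = ((Function.update u₀ o (u q) o, v o), w o)
    rw [hu'r, hu'o, hvr, hwr]
  rw [h1, h2, h3, add_zero] at hraise
  exact hraise

/-- **Vanishing from the two exchanges.** In the situation of `apply_add_apply_comp_swap_eq_zero`,
assume moreover that the third partial functions are highest-weight vectors, that the letters of
`w` at `p, q` are those of `u` (in either order), and that every pair (a letter of `u`, a letter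
of `w`) is carried, together with the common `v`-letter of the other positions, by some position
`r ∉ {p, q}`. Then `M(u, v, w) = 0`: the `w`-exchange gives `M(u,v,w) = -M(u,v,w∘(p q))`, the
`u`-exchange gives `M(u,v,w∘(p q)) = -M(u∘(p q), v, w∘(p q))`, and the latter is `M` at
`(p q) · (u, v, w)` (`v ∘ (p q) = v`), i.e. `-M(u,v,w)` by anti-invariance; so `M(u,v,w) = -M(u,v,w)`.
[cite: IkenmeyerMulmuleyWalter2017, Lemma 2.1 (anti-invariant tensors)] -/
theorem apply_eq_zero_of_exchange {χ₁ χ₃ : Weight (Fin N)} {M : Word3 N n → k}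
    (hM₁ : ∀ v w : Word N n, (fun u => M ((u, v), w)) ∈ highestWeightSpace (wordRep k N n) χ₁)
    (hM₃ : ∀ u v : Word N n, (fun w => M ((u, v), w)) ∈ highestWeightSpace (wordRep k N n) χ₃)
    (hanti : ∀ τ t, M (permute3 τ t) = ((Equiv.Perm.sign τ : ℤ) : k) * M t)
    (u v w : Word N n) {p q : Fin n} (hpq : p ≠ q) (hlt : u p < u q) (hv : v p = v q)
    (hw : (w p = u p ∧ w q = u q) ∨ (w p = u q ∧ w q = u p))
    (hsupply : ∀ o, o ≠ p → o ≠ q → ∀ x y : Fin N, (∃ o₁, u o₁ = x) → (∃ o₂, w o₂ = y) →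
      ∃ r, r ≠ p ∧ r ≠ q ∧ u r = x ∧ w r = y ∧ v r = v o) :
    M ((u, v), w) = 0 := by
  -- the `u`-exchange at `(u, v, w ∘ (p q))`
  have R2 : M ((u, v), w ∘ ⇑(Equiv.swap p q)) +
      M ((u ∘ ⇑(Equiv.swap p q), v), w ∘ ⇑(Equiv.swap p q)) = 0 := by
    refine apply_add_apply_comp_swap_eq_zero hM₁ hanti u v _ hpq hlt fun o hop hoq huo => ?_
    obtain ⟨r, hrp, hrq, hur, hwr, hvr⟩ := hsupply o hop hoq (u q) (w o) ⟨q, rfl⟩ ⟨o, rfl⟩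
    refine ⟨r, ?_, hrp, hrq, hur, hvr, ?_⟩
    · rintro rfl
      rw [huo] at hur
      exact hlt.ne hur
    · simp only [Function.comp_apply, Equiv.swap_apply_of_ne_of_ne hrp hrq,
        Equiv.swap_apply_of_ne_of_ne hop hoq, hwr]
  -- the `w`-exchange at `(u, v, w)`, through the tensor with first and third words exchanged
  have R3 : M ((u, v), w) + M ((u, v), w ∘ ⇑(Equiv.swap p q)) = 0 := by
    set M' : Word3 N n → k := fun t => M ((t.2, t.1.2), t.1.1) with hM'
    have hM'₁ : ∀ v' u' : Word N n,
        (fun w' => M' ((w', v'), u')) ∈ highestWeightSpace (wordRep k N n) χ₃ :=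
      fun v' u' => hM₃ u' v'
    have hanti' : ∀ σ t, M' (permute3 σ t) = ((Equiv.Perm.sign σ : ℤ) : k) * M' t :=
      fun σ t => hanti σ ((t.2, t.1.2), t.1.1)
    rcases hw with ⟨hwp, hwq⟩ | ⟨hwp, hwq⟩
    · have hlt' : w p < w q := by rw [hwp, hwq]; exact hlt
      have h := apply_add_apply_comp_swap_eq_zero hM'₁ hanti' w v u hpq hlt'
        fun o hop hoq hwo => by
          obtain ⟨r, hrp, hrq, hur, hwr, hvr⟩ := hsupply o hop hoq (u o) (w q) ⟨o, rfl⟩ ⟨q, rfl⟩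
          refine ⟨r, ?_, hrp, hrq, hwr, hvr, hur⟩
          rintro rfl
          rw [hwo] at hwr
          exact hlt'.ne hwr
      exact h
    · have hlt' : w q < w p := by rw [hwp, hwq]; exact hlt
      have h := apply_add_apply_comp_swap_eq_zero hM'₁ hanti' w v u hpq.symm hlt'
        fun o hoq hop hwo => by
          obtain ⟨r, hrp, hrq, hur, hwr, hvr⟩ := hsupply o hop hoq (u o) (w p) ⟨o, rfl⟩ ⟨p, rfl⟩
          refine ⟨r, ?_, hrq, hrp, hwr, hvr, hur⟩
          rintro rfl
          rw [hwo] at hwr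
          exact hlt'.ne hwr
      rw [Equiv.swap_comm] at h
      exact h
  -- anti-invariance under `(p q)` itself
  have hA : M ((u ∘ ⇑(Equiv.swap p q), v), w ∘ ⇑(Equiv.swap p q)) = -M ((u, v), w) := by
    have hvτ : v ∘ ⇑(Equiv.swap p q) = v := by
      funext o
      simp only [Function.comp_apply]
      by_cases hop : o = p
      · rw [hop, Equiv.swap_apply_left, hv]
      · by_cases hoq : o = q
        · rw [hoq, Equiv.swap_apply_right, hv]
        · rw [Equiv.swap_apply_of_ne_of_ne hop hoq]
    have h := hanti (Equiv.swap p q) ((u, v), w)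
    have e : permute3 (Equiv.swap p q) ((u, v), w) =
        ((u ∘ ⇑(Equiv.swap p q), v), w ∘ ⇑(Equiv.swap p q)) := by
      show ((u ∘ ⇑(Equiv.swap p q), v ∘ ⇑(Equiv.swap p q)), w ∘ ⇑(Equiv.swap p q)) = _
      rw [hvτ]
    rw [e, Equiv.Perm.sign_swap hpq, Units.val_neg, Units.val_one, Int.cast_neg, Int.cast_one,
      neg_one_mul] at h
    exact h
  have e2 : M ((u, v), w ∘ ⇑(Equiv.swap p q)) = M ((u, v), w) := by
    rw [eq_neg_of_add_eq_zero_left R2, hA, neg_neg]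
  rw [e2] at R3
  exact add_self_eq_zero.mp R3

end Exchange

/-! ### 3. `g((2,2,1^{s²-2}), μ, μ) = 0` for `ℓ(μ) ≤ s` -/

section Vanishing

variable {k : Type*} [Field k] [CharZero k]

/-- **The heart.** An anti-invariant triple tensor `M ∈ HW_μ ⊗ HW_{(s²,2)} ⊗ HW_μ` on words of length
`s² + 2`, `ℓ(μ) ≤ s`, vanishes identically: at a triple `(u, v, w)` with `M ≠ 0` the `s²` positions
with `v = 0` carry all of `[s] × [s]` in `(u, w)`, the two positions `p ≠ q` with `v = 1` carry
`{u p, u q} = {w p, w q}` with `u p ≠ u q` (contents `μ` and injectivity), and then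
`apply_eq_zero_of_exchange` applies. [cite: GesmundoIkenmeyerPanova2017, Prop. 19 (the case a = s² - 2)] -/
theorem antiInvariant_twoTwoCol_apply_eq_zero {a s N : ℕ} (hs : a + 2 = s * s)
    (μ : Nat.Partition (a + 4)) (hμ : μ.parts.card ≤ s) {M : Word3 N (a + 4) → k}
    (hM : M ∈ tripleHw k N (a + 4) (Weight.ofPartition N μ) (Weight.ofPartition N (rowTwo a))
      (Weight.ofPartition N μ))
    (hanti : ∀ τ t, M (permute3 τ t) = ((Equiv.Perm.sign τ : ℤ) : k) * M t)
    (t : Word3 N (a + 4)) : M t = 0 := by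
  classical
  by_contra ht
  obtain ⟨⟨u, v⟩, w⟩ := t
  have hinj := zip3_injective_of_antiInvariant_of_ne_zero k hanti ht
  have hc := fun i => wordContent_eq_of_mem_tripleHw_of_ne_zero k hM ht i
  -- contents
  have hcu : ∀ i : Fin N, wordContent u i = μ.sortedParts.getD i 0 := fun i => by
    have h := (hc i).1
    rw [show Weight.ofPartition N μ i = ((μ.sortedParts.getD i 0 : ℕ) : ℤ) from rfl] at h
    exact_mod_cast h
  have hcw : ∀ i : Fin N, wordContent w i = μ.sortedParts.getD i 0 := fun i => by
    have h := (hc i).2.2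
    rw [show Weight.ofPartition N μ i = ((μ.sortedParts.getD i 0 : ℕ) : ℤ) from rfl] at h
    exact_mod_cast h
  have hcv : ∀ i : Fin N, wordContent v i =
      (if (i : ℕ) = 0 then a + 2 else if (i : ℕ) = 1 then 2 else 0) := fun i => by
    have h := (hc i).2.1
    rw [show Weight.ofPartition N (rowTwo a) i = (((rowTwo a).sortedParts.getD i 0 : ℕ) : ℤ)
      from rfl, getD_sortedParts_rowTwo] at h
    exact_mod_cast h
  have hpos_of : ∀ (x : Word N (a + 4)) (o : Fin (a + 4)), 0 < wordContent x (x o) := fun x o =>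
    Finset.card_pos.mpr ⟨o, by simp⟩
  -- letters of `u`, `w` are `< s`
  have hus : ∀ o, ((u o : Fin N) : ℕ) < s := fun o => by
    have h := hpos_of u o
    rw [hcu, getD_sortedParts_pos_iff] at h
    exact lt_of_lt_of_le h hμ
  have hws : ∀ o, ((w o : Fin N) : ℕ) < s := fun o => by
    have h := hpos_of w o
    rw [hcw, getD_sortedParts_pos_iff] at h
    exact lt_of_lt_of_le h hμ
  -- letters of `v` are `0` (positions `Z`) or `1` (two positions)
  have hN0 : 0 < N := Fin.pos (u ⟨0, by omega⟩)
  set z0 : Fin N := ⟨0, hN0⟩ with hz0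
  have hv01 : ∀ o, v o = z0 ∨ ((v o : Fin N) : ℕ) = 1 := fun o => by
    have h := hpos_of v o
    rw [hcv] at h
    by_cases h0 : ((v o : Fin N) : ℕ) = 0
    · exact Or.inl (Fin.ext h0)
    · rw [if_neg h0] at h
      by_cases h1 : ((v o : Fin N) : ℕ) = 1
      · exact Or.inr h1
      · rw [if_neg h1] at h
        exact absurd h (lt_irrefl 0)
  set Z : Finset (Fin (a + 4)) := univ.filter (fun o => v o = z0) with hZ
  have hZcard : Z.card = s * s := by
    have h := hcv z0
    rw [if_pos (show ((z0 : Fin N) : ℕ) = 0 from rfl)] at h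
    rw [← hs, ← h, hZ]
    rfl
  have hex : ∃ o, v o ≠ z0 := by
    by_contra h
    have hZu : Z = univ := by
      rw [hZ]
      exact filter_true_of_mem fun o _ => not_not.mp (not_exists.mp h o)
    rw [hZu, card_univ, Fintype.card_fin, ← hs] at hZcard
    omega
  obtain ⟨o₁, ho₁⟩ := hex
  have hN1 : 1 < N := by
    rcases hv01 o₁ with h | h
    · exact absurd h ho₁
    · have := (v o₁).isLt
      omega
  set z1 : Fin N := ⟨1, hN1⟩ with hz1
  have hz01 : z0 ≠ z1 := by
    rw [hz0, hz1, Ne, Fin.mk.injEq]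
    exact Nat.zero_ne_one
  have hvZ1 : ∀ o, v o = z0 ∨ v o = z1 := fun o => (hv01 o).imp_right fun h => Fin.ext h
  set P : Finset (Fin (a + 4)) := univ.filter (fun o => v o = z1) with hP
  have hPcard : P.card = 2 := by
    have h := hcv z1
    rw [if_neg (show ((z1 : Fin N) : ℕ) ≠ 0 from Nat.one_ne_zero),
      if_pos (show ((z1 : Fin N) : ℕ) = 1 from rfl)] at h
    rw [← h, hP]
    rfl
  obtain ⟨p, q, hpq, hPpq⟩ := card_eq_two.mp hPcard
  have hvp : v p = z1 := by
    have : p ∈ P := by rw [hPpq]; exact mem_insert_self _ _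
    simpa [hP] using this
  have hvq : v q = z1 := by
    have : q ∈ P := by rw [hPpq]; exact mem_insert_of_mem (mem_singleton_self _)
    simpa [hP] using this
  have hvo : ∀ o, o ≠ p → o ≠ q → v o = z0 := fun o hop hoq => by
    rcases hvZ1 o with h | h
    · exact h
    · have ho : o ∈ P := by simp [hP, h]
      rw [hPpq, mem_insert, mem_singleton] at ho
      rcases ho with h' | h'
      · exact absurd h' hop
      · exact absurd h' hoq
  -- on `Z`, the pairs `(u o, w o)` exhaust `[s] × [s]`
  have hinjZ : Set.InjOn (fun o => (((u o : Fin N) : ℕ), ((w o : Fin N) : ℕ))) Z := by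
    intro o ho o' ho' h
    simp only [Prod.mk.injEq] at h
    have hvv : v o = v o' := by
      rw [hZ, coe_filter] at ho ho'
      rw [ho.2, ho'.2]
    apply hinj
    show ((u o, v o), w o) = ((u o', v o'), w o')
    rw [Fin.ext h.1, Fin.ext h.2, hvv]
  have himg := image_eq_range_product Z (fun o => ((u o : Fin N) : ℕ))
    (fun o => ((w o : Fin N) : ℕ)) s hinjZ (fun o _ => hus o) (fun o _ => hws o) hZcard
  have hsurj : ∀ x y : ℕ, x < s → y < s →
      ∃ r ∈ Z, ((u r : Fin N) : ℕ) = x ∧ ((w r : Fin N) : ℕ) = y := by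
    intro x y hx hy
    have hmem : (x, y) ∈ Z.image (fun o => (((u o : Fin N) : ℕ), ((w o : Fin N) : ℕ))) := by
      rw [himg]
      exact mem_product.mpr ⟨mem_range.mpr hx, mem_range.mpr hy⟩
    obtain ⟨r, hr, hre⟩ := mem_image.mp hmem
    simp only [Prod.mk.injEq] at hre
    exact ⟨r, hr, hre.1, hre.2⟩
  have hcountZ : ∀ l : Fin N,
      (Z.filter fun o => u o = l).card = (Z.filter fun o => w o = l).card := by
    intro l
    have h := card_filter_fst_eq_card_filter_snd Z (fun o => ((u o : Fin N) : ℕ))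
      (fun o => ((w o : Fin N) : ℕ)) s hinjZ himg l
    rw [filter_congr fun o _ => (Fin.ext_iff (a := u o) (b := l)),
      filter_congr fun o _ => (Fin.ext_iff (a := w o) (b := l))]
    exact h
  -- contents split along `Z ∪ {p, q}`
  have hZP : Z ∪ P = univ := by
    ext o
    simp only [mem_union, hZ, hP, mem_filter, mem_univ, true_and, iff_true]
    exact hvZ1 o
  have hZPd : Disjoint Z P := by
    rw [hZ, hP]
    refine disjoint_left.mpr fun o h1 h2 => hz01 ?_
    simp only [mem_filter, mem_univ, true_and] at h1 h2
    rw [← h1, ← h2]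
  have hsplit : ∀ (x : Word N (a + 4)) (l : Fin N), wordContent x l =
      (Z.filter fun o => x o = l).card + (P.filter fun o => x o = l).card := by
    intro x l
    rw [wordContent, ← hZP, filter_union, card_union_of_disjoint (disjoint_filter_filter hZPd)]
  have hE : ∀ l : Fin N, (if u p = l then 1 else 0) + (if u q = l then 1 else 0) =
      ((if w p = l then 1 else 0) + (if w q = l then 1 else 0) : ℕ) := by
    intro l
    have h1 := hsplit u l
    have h2 := hsplit w l
    rw [hcu] at h1
    rw [hcw] at h2
    have h3 := hcountZ l
    have h4 : (P.filter fun o => u o = l).card = (P.filter fun o => w o = l).card := by omega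
    rwa [hPpq, card_filter, card_filter, sum_pair hpq, sum_pair hpq] at h4
  -- `u p ≠ u q` and `{w p, w q} = {u p, u q}`
  have hune : u p ≠ u q := by
    intro h
    have e := hE (u p)
    rw [if_pos rfl, if_pos h.symm] at e
    have hw2 : w p = u p ∧ w q = u p := by
      split_ifs at e with h₁ h₂ <;> first | exact ⟨h₁, h₂⟩ | omega
    apply hpq
    apply hinj
    show ((u p, v p), w p) = ((u q, v q), w q)
    rw [hw2.1, hw2.2, h, hvp, hvq]
  have hmatch : (w p = u p ∧ w q = u q) ∨ (w p = u q ∧ w q = u p) := by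
    have e1 := hE (u p)
    have e2 := hE (u q)
    rw [if_pos rfl, if_neg (Ne.symm hune)] at e1
    rw [if_neg hune, if_pos rfl] at e2
    by_cases h1 : w p = u p
    · left
      refine ⟨h1, ?_⟩
      rw [if_neg (show w p ≠ u q from fun h => hune (h1.symm.trans h))] at e2
      by_contra hne
      rw [if_neg hne] at e2
      omega
    · right
      rw [if_neg h1] at e1
      have hwq : w q = u p := by
        by_contra hne
        rw [if_neg hne] at e1
        omega
      refine ⟨?_, hwq⟩
      rw [if_neg (show w q ≠ u q from fun h => hune (hwq.symm.trans h))] at e2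
      by_contra hne
      rw [if_neg hne] at e2
      omega
  -- the supply of fourth positions
  have hsupply : ∀ o, o ≠ p → o ≠ q → ∀ x y : Fin N, (∃ o₁, u o₁ = x) → (∃ o₂, w o₂ = y) →
      ∃ r, r ≠ p ∧ r ≠ q ∧ u r = x ∧ w r = y ∧ v r = v o := by
    rintro o hop hoq x y ⟨o₁, rfl⟩ ⟨o₂, rfl⟩
    obtain ⟨r, hrZ, hru, hrw⟩ := hsurj _ _ (hus o₁) (hws o₂)
    have hvr : v r = z0 := by
      rw [hZ] at hrZ
      simpa using hrZ
    refine ⟨r, ?_, ?_, Fin.ext hru, Fin.ext hrw, ?_⟩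
    · rintro rfl
      rw [hvp] at hvr
      exact hz01 hvr.symm
    · rintro rfl
      rw [hvq] at hvr
      exact hz01 hvr.symm
    · rw [hvr, hvo o hop hoq]
  have hM₁ := ((mem_tripleHw_iff _ _ _ M).1 hM).1
  have hM₃ := ((mem_tripleHw_iff _ _ _ M).1 hM).2.2
  rcases lt_or_gt_of_ne hune with hlt | hlt
  · exact ht (apply_eq_zero_of_exchange hM₁ hM₃ hanti u v w hpq hlt (hvp.trans hvq.symm)
      hmatch hsupply)
  · refine ht (apply_eq_zero_of_exchange hM₁ hM₃ hanti u v w hpq.symm hlt (hvq.trans hvp.symm)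
      ?_ fun o hoq hop x y hx hy => ?_)
    · rcases hmatch with ⟨h1, h2⟩ | ⟨h1, h2⟩
      · exact Or.inl ⟨h2, h1⟩
      · exact Or.inr ⟨h2, h1⟩
    · obtain ⟨r, hrp, hrq, h⟩ := hsupply o hop hoq x y hx hy
      exact ⟨r, hrq, hrp, h⟩

variable (k) in
/-- **`g((2,2,1^a), μ, μ) = 0` whenever `a + 2 = s²` and `ℓ(μ) ≤ s`** (over any field of
characteristic zero): `g(λ, μ, μ) = g(μ, λᵀ, μᵀ)` (`kroneckerCoeff_comm₁₂_holds`,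
`kroneckerCoeff_transpose`), a positive value would give a nonzero anti-invariant tensor in
`HW_μ ⊗ HW_{(a+2, 2)} ⊗ HW_μ` (`exists_antiInvariant_of_kroneckerCoeff_pos`, IMW Lemma 2.1), and there
is none (`antiInvariant_twoTwoCol_apply_eq_zero`). GIP's printed proof of Prop. 19 needs this
coefficient to be positive for some `μ` with `ℓ(μ) ≤ ⌈√(a+2)⌉ = s`.
[cite: GesmundoIkenmeyerPanova2017, Prop. 19 (the case a = s² - 2)] -/
theorem kroneckerCoeff_twoTwoCol_eq_zero {a s : ℕ} (hs : a + 2 = s * s)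
    (μ : Nat.Partition (a + 4)) (hμ : μ.parts.card ≤ s) :
    kroneckerCoeff k (twoTwoCol a) μ μ = 0 := by
  by_contra hne
  have hpos : 0 < kroneckerCoeff k μ (rowTwo a) μ.transpose := by
    have h := Nat.pos_of_ne_zero hne
    rwa [kroneckerCoeff_comm₁₂_holds k, kroneckerCoeff_transpose k] at h
  have hN : μ.parts.card ≤ a + 4 := μ.card_parts_le_size
  obtain ⟨M, hM, hM0, hanti⟩ :=
    exists_antiInvariant_of_kroneckerCoeff_pos k hN (rowTwo a).card_parts_le_size hN hpos
  exact hM0 (funext fun t => antiInvariant_twoTwoCol_apply_eq_zero hs μ hμ hM hanti t)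

end Vanishing

/-! ### 4. The refutation of the printed Prop. 19 -/

/-- **`sm((2,2,1^a), s) = 0` for `a + 2 = s²`**: every `sk((2,2,1^a), μ)` with `ℓ(μ) ≤ s` vanishes,
since `sk ≤ g` ((3.1), `kroneckerCoeff_pos_of_skPos`) and `g((2,2,1^a), μ, μ) = 0`.
[cite: GesmundoIkenmeyerPanova2017, Prop. 19 and (3.1)] -/
theorem not_smPos_twoTwoCol {a s : ℕ} (hs : a + 2 = s * s) : ¬ SmPos s (twoTwoCol a) := by
  rintro ⟨μ, hμ, hsk⟩
  have h := kroneckerCoeff_pos_of_skPos hsk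
  rw [kroneckerCoeff_twoTwoCol_eq_zero ℂ hs μ hμ] at h
  exact lt_irrefl 0 h

/-- **`am((2,2,1^a), s) = 0` for `a + 2 = s²`**, likewise from `ak ≤ g` (`kroneckerCoeff_pos_of_akPos`).
[cite: GesmundoIkenmeyerPanova2017, Prop. 19 and (3.1)] -/
theorem not_amPos_twoTwoCol {a s : ℕ} (hs : a + 2 = s * s) : ¬ AmPos s (twoTwoCol a) := by
  rintro ⟨μ, hμ, hak⟩
  have h := kroneckerCoeff_pos_of_akPos hak
  rw [kroneckerCoeff_twoTwoCol_eq_zero ℂ hs μ hμ] at h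
  exact lt_irrefl 0 h

/-- `⌈√(s²)⌉ = s` in the rendering `⌊√(a+1)⌋ + 1` of `⌈√(a+2)⌉`, `a = s² - 2`, `s ≥ 2`. [folklore] -/
theorem sqrt_sq_sub_two_add_one {s : ℕ} (hs : 2 ≤ s) : Nat.sqrt (s * s - 2 + 1) + 1 = s := by
  obtain ⟨t, rfl⟩ : ∃ t, s = t + 1 := ⟨s - 1, by omega⟩
  have hsq : (t + 1) * (t + 1) = t * t + 2 * t + 1 := by ring
  have e : (t + 1) * (t + 1) - 2 + 1 = t * t + 2 * t := by
    rw [hsq]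
    omega
  rw [e, Nat.sqrt_add_eq t (by omega)]

/-- **GIP Prop. 19 fails at every `a = s² - 2`, `s ≥ 7`**: then `max{7, ⌈√(a+2)⌉} = s` and both
`sm((2,2,1^a), s)` and `am((2,2,1^a), s)` vanish (e.g. `a = 47, 62, 79, …`). The corrected statement
with one more row (`GIP2017_prop19_corrected_holds`) is therefore sharp along this sequence.
[cite: GesmundoIkenmeyerPanova2017, Prop. 19] -/
theorem GIP2017_prop19_fails {s : ℕ} (hs : 7 ≤ s) :
    ¬ (SmPos (max 7 (Nat.sqrt (s * s - 2 + 1) + 1)) (twoTwoCol (s * s - 2)) ∨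
        AmPos (max 7 (Nat.sqrt (s * s - 2 + 1) + 1)) (twoTwoCol (s * s - 2))) := by
  have h49 : 7 * 7 ≤ s * s := Nat.mul_le_mul hs hs
  have ha : s * s - 2 + 2 = s * s := by omega
  have hmax : max 7 (Nat.sqrt (s * s - 2 + 1) + 1) = s := by
    rw [sqrt_sq_sub_two_add_one (le_trans (by norm_num) hs), max_eq_right hs]
  rw [hmax]
  rintro (h | h)
  · exact not_smPos_twoTwoCol ha h
  · exact not_amPos_twoTwoCol ha h

-- `linter.deprecated` is switched off for the next declaration only: this IS the refutation of the
-- record `GIP2017_prop19` of `GCTMatrixPoweringColumns.lean` (deprecated there since the verdict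
-- clean-up of 2026-08-15 precisely because of this theorem) and must name it. REMOVE-WHEN the
-- record is deleted.
set_option linter.deprecated false in
/-- **The record `GIP2017_prop19` (GIP Prop. 19 as printed) is FALSE**: its instance `a = 47`
(`ℓ = max{7, ⌈√49⌉} = 7`, `λ = (2,2,1^{47}) ⊢ 51`) asserts `sm(λ, 7) > 0 ∨ am(λ, 7) > 0`, and both
vanish. This is the refuting theorem the deprecated record points to (verdict clean-up
2026-08-15: `GIP2017_prop19` is no longer a named fact of the tree). The tree's proof of GIP
Thm. 10 uses the corrected `GIP2017_prop19_corrected_holds` instead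
(`GCTMatrixPoweringProp17.lean`). [cite: GesmundoIkenmeyerPanova2017, Prop. 19] -/
theorem GIP2017_prop19_false : ¬ GIP2017_prop19 := fun h =>
  GIP2017_prop19_fails le_rfl (h (7 * 7 - 2))

end Literature.Barriers.ValiantsHypothesis

end
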